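import Literature.Geometry.Lorentzian.VolumeChartIntegral
import Literature.Geometry.Lorentzian.ChartLaplacian
import Literature.Geometry.Lorentzian.GreenIdentityCompactSupport
import Literature.Geometry.Riemannian.LipschitzSmoothing
import HarnessLib

/-!
# Chart test functions: transplanting compactly supported functions from a chart target to the
# manifold, their integrals and their gradients

For a manifold `M` modelled on `ℝᵐ` (`ChartedSpace (EuclideanSpace ℝ (Fin m)) M`, model `𝓡 m`), a
point `p`, its extended chart `φ = extChartAt (𝓡 m) p` and a function `Φ` on `ℝᵐ` with compact
support inside `φ.target`, the TRANSPLANT of `Φ` is the function `𝟙_{φ.source} · (Φ ∘ φ)` on `M`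
(Mathlib's `Set.indicator`; no new definition). This is the device by which Euclidean test
functions are moved to a Riemannian manifold in Aubin 1982, proof of Thm. 6.7 (α) / Lemma 2.24
("Setting `f̃(x) = f(exp_P x)` … Since `(1−ε)^{n−1} dE ≤ dV ≤ (1+ε)^{n−1} dE` and
`|∇_E f̃| ≤ (1+ε)|∇f|` …"), here for an arbitrary chart in place of `exp_P`. Proved:

* `chartTransplant_apply_of_mem`, `chartTransplant_symm_apply`, `tsupport_chartTransplant_subset`,
  `hasCompactSupport_chartTransplant`, `contMDiff_chartTransplant`, `continuous_chartTransplant`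
  — the transplant is `Φ ∘ φ` on the chart domain, `C^n` if `Φ` is, with compact support
  `⊆ φ⁻¹(tsupport Φ) ⊆ φ.source`;
* `integral_chartTransplant` — `∫_M 𝟙(Φ ∘ φ) dV_g = ∫_{φ.target} √(det g_{ij}) Φ dy`
  (`integral_eq_integral_chart`, `VolumeChartIntegral.lean`; Chavel 2006, (III.3.6)), and
  `integral_chartTransplant_le_and_le` — two-sided bounds `c₁∫Φ ≤ ∫𝟙(Φ∘φ) dV ≤ c₂∫Φ` from
  `c₁ ≤ √(det g_{ij}) ≤ c₂` on `tsupport Φ`, `Φ ≥ 0`;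
* `exists_closedBall_density_near` — the density `√(det g_{ij})` is within a factor `1 ± κ` of its
  value at `φ(p)` on a small closed ball (Aubin's `(1±ε)^{n−1}`);
* `gradSq_chartTransplant_le` — the pointwise gradient bound `g⁻¹(dψ,dψ) ≤ (C D)²` for the
  transplant `ψ` from `‖A(dφ v)‖ ≤ C|v|_g` (a chart linearisation `A`,
  `eventually_norm_symmL_le_and_norm_comp_le` of `VolumeChartFormula.lean`) and
  `|dΦ(w)| ≤ D‖A w‖` (Aubin's `|∇_E f̃| ≤ (1+ε)|∇f|`), and `gradSq_eq_zero_of_notMem_tsupport`.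

Everything is proved; no definitions, no named facts. Consumed by
`AubinYamabeSphereProofs.lean` (Aubin's `Y(M,[g]) ≤ Y(S⁴)`).

## References

* T. Aubin, *Nonlinear Analysis on Manifolds. Monge–Ampère Equations*, Grundlehren 252, Springer
  1982, Ch. 2, Lemma 2.24; Ch. 6, Thm. 6.7. [Aubin1982]
* I. Chavel, *Riemannian Geometry: A Modern Introduction*, 2nd ed., CUP 2006, §III.3, (III.3.6).
  [Chavel2006]
-/

noncomputable section

open Set Filter Function Manifold Metric Module MeasureTheory Bundle
open scoped Manifold ContDiff Topology

namespace Literature.Geometry.Riemannian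

open Literature.Geometry.Lorentzian (PseudoRiemannianMetric riemannianMeasure chartGramMatrix)
open Literature.Geometry.Lorentzian.PseudoRiemannianMetric
open Literature.Geometry.Lorentzian

variable {m : ℕ} {M : Type*} [TopologicalSpace M] [ChartedSpace (EuclideanSpace ℝ (Fin m)) M]

variable {X : Type*}

/-! ### Transplanting a function on the chart target to the manifold -/

section Transplant

variable [Zero X] {p : M} {Φ : EuclideanSpace ℝ (Fin m) → X}

/-- The transplant `𝟙_{φ.source} · (Φ ∘ φ)` of a chart function agrees with `Φ ∘ φ` on the chart
domain (`φ = extChartAt p`). [folklore] -/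
theorem chartTransplant_apply_of_mem {x : M} (hx : x ∈ (extChartAt (𝓡 m) p).source) :
    (extChartAt (𝓡 m) p).source.indicator (Φ ∘ extChartAt (𝓡 m) p) x = Φ (extChartAt (𝓡 m) p x) :=
  indicator_of_mem hx _

/-- The transplant vanishes off the chart domain. [folklore] -/
theorem chartTransplant_apply_of_notMem {x : M} (hx : x ∉ (extChartAt (𝓡 m) p).source) :
    (extChartAt (𝓡 m) p).source.indicator (Φ ∘ extChartAt (𝓡 m) p) x = 0 :=
  indicator_of_notMem hx _

/-- Read back in the chart, the transplant is the original function on the chart target.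
[folklore] -/
theorem chartTransplant_symm_apply {y : EuclideanSpace ℝ (Fin m)} (hy : y ∈ (extChartAt (𝓡 m) p).target) :
    (extChartAt (𝓡 m) p).source.indicator (Φ ∘ extChartAt (𝓡 m) p) ((extChartAt (𝓡 m) p).symm y) = Φ y := by
  rw [chartTransplant_apply_of_mem ((extChartAt (𝓡 m) p).map_target hy), (extChartAt (𝓡 m) p).right_inv hy]

/-- Near a point of the (open) chart domain the transplant is `Φ ∘ φ`. [folklore] -/
theorem chartTransplant_eventuallyEq_of_mem {x : M} (hx : x ∈ (extChartAt (𝓡 m) p).source) :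
    (extChartAt (𝓡 m) p).source.indicator (Φ ∘ extChartAt (𝓡 m) p) =ᶠ[𝓝 x] Φ ∘ extChartAt (𝓡 m) p := by
  filter_upwards [(isOpen_extChartAt_source p).mem_nhds hx] with z hz
  exact indicator_of_mem hz _

/-- The support of the transplant lies in the inverse-chart image of the topological support of
`Φ`. [folklore] -/
theorem support_chartTransplant_subset :
    support ((extChartAt (𝓡 m) p).source.indicator (Φ ∘ extChartAt (𝓡 m) p)) ⊆
      (extChartAt (𝓡 m) p).symm '' (tsupport Φ ∩ (extChartAt (𝓡 m) p).target) := by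
  intro x hx
  rw [mem_support] at hx
  by_cases hxs : x ∈ (extChartAt (𝓡 m) p).source
  · rw [indicator_of_mem hxs] at hx
    refine ⟨extChartAt (𝓡 m) p x, ⟨subset_tsupport _ hx, (extChartAt (𝓡 m) p).map_source hxs⟩, ?_⟩
    exact (extChartAt (𝓡 m) p).left_inv hxs
  · exact absurd (indicator_of_notMem hxs _) hx

/-- The inverse-chart image of a compact subset of the chart target is compact. [folklore] -/
theorem isCompact_extChartAt_symm_image {K : Set (EuclideanSpace ℝ (Fin m))} (hK : IsCompact K)
    (hKt : K ⊆ (extChartAt (𝓡 m) p).target) : IsCompact ((extChartAt (𝓡 m) p).symm '' K) :=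
  hK.image_of_continuousOn ((continuousOn_extChartAt_symm p).mono hKt)

/-- The inverse-chart image of a subset of the chart target lies in the chart domain. [folklore] -/
theorem extChartAt_symm_image_subset_source {K : Set (EuclideanSpace ℝ (Fin m))}
    (hKt : K ⊆ (extChartAt (𝓡 m) p).target) :
    (extChartAt (𝓡 m) p).symm '' K ⊆ (extChartAt (𝓡 m) p).source := by
  rintro _ ⟨y, hy, rfl⟩
  exact (extChartAt (𝓡 m) p).map_target (hKt hy)

variable [T2Space M]

/-- **Support of the transplant.** If `Φ` has compact support inside the chart target then the
topological support of its transplant lies in the (compact) inverse-chart image of `tsupport Φ`,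
inside the chart domain. [folklore] -/
theorem tsupport_chartTransplant_subset (hΦc : HasCompactSupport Φ)
    (hΦt : tsupport Φ ⊆ (extChartAt (𝓡 m) p).target) :
    tsupport ((extChartAt (𝓡 m) p).source.indicator (Φ ∘ extChartAt (𝓡 m) p)) ⊆
      (extChartAt (𝓡 m) p).symm '' tsupport Φ := by
  have hK : IsCompact ((extChartAt (𝓡 m) p).symm '' tsupport Φ) :=
    isCompact_extChartAt_symm_image hΦc hΦt
  refine closure_minimal ?_ hK.isClosed
  refine support_chartTransplant_subset.trans (image_mono inter_subset_left)

/-- The transplant of a compactly supported chart function has compact support. [folklore] -/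
theorem hasCompactSupport_chartTransplant (hΦc : HasCompactSupport Φ)
    (hΦt : tsupport Φ ⊆ (extChartAt (𝓡 m) p).target) :
    HasCompactSupport ((extChartAt (𝓡 m) p).source.indicator (Φ ∘ extChartAt (𝓡 m) p)) :=
  (isCompact_extChartAt_symm_image hΦc hΦt).of_isClosed_subset (isClosed_tsupport _)
    (tsupport_chartTransplant_subset hΦc hΦt)

/-- The topological support of the transplant lies in the chart domain. [folklore] -/
theorem tsupport_chartTransplant_subset_source (hΦc : HasCompactSupport Φ)
    (hΦt : tsupport Φ ⊆ (extChartAt (𝓡 m) p).target) :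
    tsupport ((extChartAt (𝓡 m) p).source.indicator (Φ ∘ extChartAt (𝓡 m) p)) ⊆
      (extChartAt (𝓡 m) p).source :=
  (tsupport_chartTransplant_subset hΦc hΦt).trans (extChartAt_symm_image_subset_source hΦt)

/-- Off the inverse-chart image of `tsupport Φ` the transplant vanishes identically near the
point. [folklore] -/
theorem chartTransplant_eventuallyEq_zero (hΦc : HasCompactSupport Φ)
    (hΦt : tsupport Φ ⊆ (extChartAt (𝓡 m) p).target) {x : M}
    (hx : x ∉ (extChartAt (𝓡 m) p).symm '' tsupport Φ) :
    (extChartAt (𝓡 m) p).source.indicator (Φ ∘ extChartAt (𝓡 m) p) =ᶠ[𝓝 x] fun _ => 0 :=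
  notMem_tsupport_iff_eventuallyEq.1 fun h => hx (tsupport_chartTransplant_subset hΦc hΦt h)

end Transplant

section Smooth

variable [IsManifold (𝓡 m) ∞ M] [T2Space M] {p : M}

/-- **Smoothness of the transplant.** A `C^n` chart function with compact support in the chart
target transplants to a `C^n` function on the manifold (`C^n` at the points of the chart domain
as `Φ ∘ φ`, identically zero near every other point). [folklore] -/
theorem contMDiff_chartTransplant {F : Type*} [NormedAddCommGroup F] [NormedSpace ℝ F]
    {Φ : EuclideanSpace ℝ (Fin m) → F} {n : ℕ∞ω} (hn : n ≤ (∞ : ℕ∞ω)) (hΦ : ContDiff ℝ n Φ)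
    (hΦc : HasCompactSupport Φ) (hΦt : tsupport Φ ⊆ (extChartAt (𝓡 m) p).target) :
    ContMDiff (𝓡 m) 𝓘(ℝ, F) n ((extChartAt (𝓡 m) p).source.indicator (Φ ∘ extChartAt (𝓡 m) p)) := by
  refine contMDiff_of_tsupport fun x hx => ?_
  have hxs : x ∈ (extChartAt (𝓡 m) p).source := tsupport_chartTransplant_subset_source hΦc hΦt hx
  have hxc : x ∈ (chartAt (EuclideanSpace ℝ (Fin m)) p).source := by rwa [← extChartAt_source (𝓡 m)]
  have h1 : ContMDiffAt (𝓡 m) 𝓘(ℝ, F) n (Φ ∘ extChartAt (𝓡 m) p) x :=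
    (hΦ.contMDiff.contMDiffAt).comp x
      ((contMDiffAt_extChartAt' (I := 𝓡 m) (n := (∞ : ℕ∞ω)) hxc).of_le hn)
  exact h1.congr_of_eventuallyEq (chartTransplant_eventuallyEq_of_mem hxs)

omit [IsManifold (𝓡 m) ∞ M] in
/-- **Continuity of the transplant** of a continuous chart function with compact support in the
chart target. [folklore] -/
theorem continuous_chartTransplant {F : Type*} [TopologicalSpace F] [Zero F]
    {Φ : EuclideanSpace ℝ (Fin m) → F} (hΦ : Continuous Φ)
    (hΦc : HasCompactSupport Φ) (hΦt : tsupport Φ ⊆ (extChartAt (𝓡 m) p).target) :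
    Continuous ((extChartAt (𝓡 m) p).source.indicator (Φ ∘ extChartAt (𝓡 m) p)) := by
  refine continuous_iff_continuousAt.2 fun x => ?_
  by_cases hx : x ∈ (extChartAt (𝓡 m) p).symm '' tsupport Φ
  · have hxs : x ∈ (extChartAt (𝓡 m) p).source := extChartAt_symm_image_subset_source hΦt hx
    have h1 : ContinuousAt (Φ ∘ extChartAt (𝓡 m) p) x :=
      hΦ.continuousAt.comp (continuousAt_extChartAt' hxs)
    exact h1.congr_of_eventuallyEq (chartTransplant_eventuallyEq_of_mem hxs)
  · exact (continuousAt_const (y := (0 : F))).congr_of_eventuallyEq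
      (chartTransplant_eventuallyEq_zero hΦc hΦt hx)

end Smooth


variable [IsManifold (𝓡 m) ∞ M]

/-! ### A continuity lemma on the model space -/

omit [IsManifold (𝓡 m) ∞ M] in
/-- A product `ρ · Φ` with `ρ` continuous on an open set containing the topological support of the
continuous function `Φ` is continuous everywhere. [folklore] -/
theorem continuous_mul_of_continuousOn_of_tsupport_subset {Y : Type*} [TopologicalSpace Y]
    {ρ Φ : Y → ℝ} {U : Set Y} (hU : IsOpen U) (hρ : ContinuousOn ρ U) (hΦ : Continuous Φ)
    (hΦU : tsupport Φ ⊆ U) : Continuous fun y => ρ y * Φ y := by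
  refine continuous_iff_continuousAt.2 fun y => ?_
  by_cases hy : y ∈ tsupport Φ
  · exact (hρ.continuousAt (hU.mem_nhds (hΦU hy))).mul hΦ.continuousAt
  · have hev : Φ =ᶠ[𝓝 y] fun _ => 0 := notMem_tsupport_iff_eventuallyEq.1 hy
    have hev' : (fun z => ρ z * Φ z) =ᶠ[𝓝 y] fun _ => 0 := by
      filter_upwards [hev] with z hz
      rw [hz, mul_zero]
    exact (continuousAt_const (y := (0:ℝ))).congr_of_eventuallyEq hev'

/-! ### Integrals of transplanted functions -/

section Integral

variable [T3Space M] [MeasurableSpace M] [BorelSpace M]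
  (g₀ : ContMDiffRiemannianMetric (𝓡 m) ∞ (EuclideanSpace ℝ (Fin m)) (TangentSpace (𝓡 m) : M → Type _))
  (p : M)

/-- **Integral of a transplanted function** (chart formula): for `Φ` continuous with compact
support in the chart target of `p`,
`∫_M 𝟙_{φ.source}(Φ ∘ φ) dV_g = ∫_{φ.target} √(det g_{ij}(y)) Φ(y) dy`
(`integral_eq_integral_chart`; Chavel 2006, §III.3, (III.3.6)). [cite: Chavel2006, §III.3 (III.3.6)] -/
theorem integral_chartTransplant {Φ : EuclideanSpace ℝ (Fin m) → ℝ} (hΦ : Continuous Φ)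
    (hΦc : HasCompactSupport Φ) (hΦt : tsupport Φ ⊆ (extChartAt (𝓡 m) p).target) :
    ∫ x, (extChartAt (𝓡 m) p).source.indicator (Φ ∘ extChartAt (𝓡 m) p) x ∂(riemannianMeasure g₀) =
      ∫ y in (extChartAt (𝓡 m) p).target, Real.sqrt (chartGramMatrix g₀ p y).det * Φ y := by
  have hT2 : T2Space M := inferInstance
  have hu : Measurable ((extChartAt (𝓡 m) p).source.indicator (Φ ∘ extChartAt (𝓡 m) p)) :=
    (continuous_chartTransplant hΦ hΦc hΦt).measurable
  have hsupp : support ((extChartAt (𝓡 m) p).source.indicator (Φ ∘ extChartAt (𝓡 m) p)) ⊆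
      (extChartAt (𝓡 m) p).source :=
    (subset_tsupport _).trans (tsupport_chartTransplant_subset_source hΦc hΦt)
  rw [integral_eq_integral_chart g₀ p hu hsupp]
  refine setIntegral_congr_fun (isOpen_extChartAt_target p).measurableSet fun y hy => ?_
  rw [chartTransplant_symm_apply hy, smul_eq_mul]

/-- **Two-sided bounds for the integral of a nonnegative transplanted function** from bounds on
the density on its support: if `c₁ ≤ √(det g_{ij}) ≤ c₂` on `tsupport Φ` and `Φ ≥ 0`, then
`c₁ ∫ Φ dy ≤ ∫_M 𝟙(Φ ∘ φ) dV_g ≤ c₂ ∫ Φ dy`. [cite: Chavel2006, §III.3 (III.3.6)] -/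
theorem integral_chartTransplant_le_and_le {Φ : EuclideanSpace ℝ (Fin m) → ℝ} (hΦ : Continuous Φ)
    (hΦc : HasCompactSupport Φ) (hΦt : tsupport Φ ⊆ (extChartAt (𝓡 m) p).target)
    (hΦ0 : ∀ y, 0 ≤ Φ y) {c₁ c₂ : ℝ}
    (hc : ∀ y ∈ tsupport Φ, c₁ ≤ Real.sqrt (chartGramMatrix g₀ p y).det ∧
      Real.sqrt (chartGramMatrix g₀ p y).det ≤ c₂) :
    c₁ * ∫ y, Φ y ≤ ∫ x, (extChartAt (𝓡 m) p).source.indicator (Φ ∘ extChartAt (𝓡 m) p) x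
        ∂(riemannianMeasure g₀) ∧
      ∫ x, (extChartAt (𝓡 m) p).source.indicator (Φ ∘ extChartAt (𝓡 m) p) x ∂(riemannianMeasure g₀)
        ≤ c₂ * ∫ y, Φ y := by
  rw [integral_chartTransplant g₀ p hΦ hΦc hΦt]
  set ρ : EuclideanSpace ℝ (Fin m) → ℝ := fun y => Real.sqrt (chartGramMatrix g₀ p y).det with hρ
  have hΦ0' : ∀ y, y ∉ tsupport Φ → Φ y = 0 := fun y hy => image_eq_zero_of_notMem_tsupport hy
  have h1 : ∫ y in (extChartAt (𝓡 m) p).target, ρ y * Φ y = ∫ y, ρ y * Φ y := by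
    refine setIntegral_eq_integral_of_forall_compl_eq_zero fun y hy => ?_
    rw [hΦ0' y (fun h => hy (hΦt h)), mul_zero]
  rw [h1]
  have hρc : ContinuousOn ρ (extChartAt (𝓡 m) p).target := continuousOn_sqrt_det_chartGramMatrix g₀ p
  have hprod : Continuous fun y => ρ y * Φ y :=
    continuous_mul_of_continuousOn_of_tsupport_subset (isOpen_extChartAt_target p) hρc hΦ hΦt
  have hprodc : HasCompactSupport fun y => ρ y * Φ y := hΦc.mul_left
  have hint : Integrable (fun y => ρ y * Φ y) := hprod.integrable_of_hasCompactSupport hprodc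
  have hintΦ : Integrable Φ := hΦ.integrable_of_hasCompactSupport hΦc
  constructor
  · rw [← MeasureTheory.integral_const_mul]
    refine integral_mono (hintΦ.const_mul _) hint fun y => ?_
    by_cases hy : y ∈ tsupport Φ
    · exact mul_le_mul_of_nonneg_right (hc y hy).1 (hΦ0 y)
    · simp only [hΦ0' y hy, mul_zero, le_refl]
  · rw [← MeasureTheory.integral_const_mul]
    refine integral_mono hint (hintΦ.const_mul _) fun y => ?_
    by_cases hy : y ∈ tsupport Φ
    · exact mul_le_mul_of_nonneg_right (hc y hy).2 (hΦ0 y)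
    · simp only [hΦ0' y hy, mul_zero, le_refl]

omit [T3Space M] [MeasurableSpace M] [BorelSpace M] in
/-- **The Riemannian density is nearly constant near a point of the chart**: for `κ > 0` there is
a closed ball around `φ(p)` inside the chart target on which
`(1−κ)ρ(φ p) ≤ ρ ≤ (1+κ)ρ(φ p)`, `ρ = √(det g_{ij})` (continuity and positivity of the density,
`VolumeChartIntegral.lean`). [folklore] -/
theorem exists_closedBall_density_near {κ : ℝ} (hκ : 0 < κ) :
    ∃ r : ℝ, 0 < r ∧ closedBall (extChartAt (𝓡 m) p p) r ⊆ (extChartAt (𝓡 m) p).target ∧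
      ∀ y ∈ closedBall (extChartAt (𝓡 m) p p) r,
        (1 - κ) * Real.sqrt (chartGramMatrix g₀ p (extChartAt (𝓡 m) p p)).det ≤
            Real.sqrt (chartGramMatrix g₀ p y).det ∧
          Real.sqrt (chartGramMatrix g₀ p y).det ≤
            (1 + κ) * Real.sqrt (chartGramMatrix g₀ p (extChartAt (𝓡 m) p p)).det := by
  set y₀ := extChartAt (𝓡 m) p p with hy₀
  set ρ : EuclideanSpace ℝ (Fin m) → ℝ := fun y => Real.sqrt (chartGramMatrix g₀ p y).det with hρ
  have hy₀t : y₀ ∈ (extChartAt (𝓡 m) p).target := mem_extChartAt_target p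
  have hρ0 : 0 < ρ y₀ := sqrt_det_chartGramMatrix_pos g₀ p hy₀t
  have hcont : ContinuousAt ρ y₀ :=
    (continuousOn_sqrt_det_chartGramMatrix g₀ p).continuousAt
      ((isOpen_extChartAt_target p).mem_nhds hy₀t)
  obtain ⟨δ₁, hδ₁, hball₁⟩ := Metric.mem_nhds_iff.1 ((isOpen_extChartAt_target p).mem_nhds hy₀t)
  obtain ⟨δ₂, hδ₂, hball₂⟩ := Metric.continuousAt_iff.1 hcont (κ * ρ y₀) (by positivity)
  refine ⟨min δ₁ δ₂ / 2, by positivity, ?_, fun y hy => ?_⟩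
  · exact (closedBall_subset_ball (by
      have := min_le_left δ₁ δ₂; linarith)).trans hball₁
  · have hy' : dist y y₀ < δ₂ := by
      have := min_le_right δ₁ δ₂
      exact lt_of_le_of_lt (mem_closedBall.1 hy) (by linarith)
    have h := hball₂ hy'
    rw [Real.dist_eq, abs_lt] at h
    constructor <;> nlinarith [h.1, h.2]

end Integral


/-! ### The gradient of a transplanted function -/

section Gradient

variable (g₀ : ContMDiffRiemannianMetric (𝓡 m) ∞ (EuclideanSpace ℝ (Fin m)) (TangentSpace (𝓡 m) : M → Type _))
  (p : M)

/-- The gradient square `g⁻¹(dψ,dψ)` of a function vanishes at every point outside its topological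
support. [folklore] -/
theorem gradSq_eq_zero_of_notMem_tsupport {ψ : M → ℝ} {x : M} (hx : x ∉ tsupport ψ) :
    (ofRiemannian g₀).gradSq ψ x = 0 := by
  have h0 := mvfderiv_eq_zero_of_eventuallyEq_zero (I := 𝓡 m) (notMem_tsupport_iff_eventuallyEq.1 hx)
  simp [PseudoRiemannianMetric.gradSq, h0, PseudoRiemannianMetric.innerDual]

/-- **Pointwise gradient bound for a transplanted function through a chart linearisation.** Let
`A` be a linear map of the model space with `‖A (dφ_x v)‖ ≤ C |v|_g` for all `v ∈ T_xM` at a point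
`x` of the chart domain (`φ = extChartAt p`; for a chart linearisation at `p`,
`‖A w‖ = |D(φ⁻¹)_{φ p} w|_g`, this holds near `p` for every `C > 1`,
`eventually_norm_symmL_le_and_norm_comp_le`), and let `Φ` be differentiable at `φ x` with
`|dΦ_{φ x}(w)| ≤ D ‖A w‖`. Then the transplant `ψ = 𝟙_{φ.source}(Φ ∘ φ)` has
`g⁻¹(dψ, dψ)(x) ≤ (C D)²` (chain rule `dψ_x = dΦ_{φ x} ∘ dφ_x` and Cauchy–Schwarz,
`gradSq_le_sq_of_forall_abs_mvfderiv_le`). This is the pointwise form of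
`|∇_E f̃| ≤ (1+ε)|∇f|` in the proof of Aubin 1982, Lemma 2.24. [cite: Aubin1982, Ch. 2, Lemma 2.24] -/
theorem gradSq_chartTransplant_le {A : EuclideanSpace ℝ (Fin m) →L[ℝ] EuclideanSpace ℝ (Fin m)}
    {C D : ℝ} (hC : 0 ≤ C) (hD : 0 ≤ D) {x : M} (hx : x ∈ (extChartAt (𝓡 m) p).source)
    (hcomp : ∀ v : TangentSpace (𝓡 m) x,
      ‖A (mfderiv (𝓡 m) 𝓘(ℝ, EuclideanSpace ℝ (Fin m)) (extChartAt (𝓡 m) p) x v)‖ ≤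
        C * Real.sqrt (g₀.inner x v v))
    {Φ : EuclideanSpace ℝ (Fin m) → ℝ} (hΦ : DifferentiableAt ℝ Φ (extChartAt (𝓡 m) p x))
    (hDb : ∀ w, |fderiv ℝ Φ (extChartAt (𝓡 m) p x) w| ≤ D * ‖A w‖) :
    (ofRiemannian g₀).gradSq ((extChartAt (𝓡 m) p).source.indicator (Φ ∘ extChartAt (𝓡 m) p)) x ≤
      (C * D) ^ 2 := by
  set ψ := (extChartAt (𝓡 m) p).source.indicator (Φ ∘ extChartAt (𝓡 m) p) with hψ
  have hxc : x ∈ (chartAt (EuclideanSpace ℝ (Fin m)) p).source := by rwa [← extChartAt_source (𝓡 m)]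
  have hψev : ψ =ᶠ[𝓝 x] Φ ∘ extChartAt (𝓡 m) p := chartTransplant_eventuallyEq_of_mem hx
  have hΦm : MDifferentiableAt 𝓘(ℝ, EuclideanSpace ℝ (Fin m)) 𝓘(ℝ, ℝ) Φ (extChartAt (𝓡 m) p x) :=
    hΦ.mdifferentiableAt
  have hcompd : MDifferentiableAt (𝓡 m) 𝓘(ℝ, ℝ) (Φ ∘ extChartAt (𝓡 m) p) x :=
    hΦm.comp x (mdifferentiableAt_extChartAt hxc)
  have hψd : MDifferentiableAt (𝓡 m) 𝓘(ℝ, ℝ) ψ x := hcompd.congr_of_eventuallyEq hψev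
  -- `ψ ∘ φ⁻¹ = Φ` near `φ x`
  have hrepr : ψ ∘ (extChartAt (𝓡 m) p).symm =ᶠ[𝓝 (extChartAt (𝓡 m) p x)] Φ := by
    filter_upwards [(isOpen_extChartAt_target p).mem_nhds ((extChartAt (𝓡 m) p).map_source hx)]
      with y hy
    exact chartTransplant_symm_apply hy
  refine gradSq_le_sq_of_forall_abs_mvfderiv_le (ofRiemannian g₀) (isRiemannian_ofRiemannian g₀)
    (mul_nonneg hC hD) fun v => ?_
  set w : EuclideanSpace ℝ (Fin m) :=
    mfderiv (𝓡 m) 𝓘(ℝ, EuclideanSpace ℝ (Fin m)) (extChartAt (𝓡 m) p) x v with hw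
  have hv : mfderivWithin 𝓘(ℝ, EuclideanSpace ℝ (Fin m)) (𝓡 m) (extChartAt (𝓡 m) p).symm
      (range (𝓡 m)) (extChartAt (𝓡 m) p x) w = v := by
    have h := mfderivWithin_extChartAt_symm_comp_mfderiv_extChartAt' (I := 𝓡 m) hx
    have h2 : ((mfderivWithin 𝓘(ℝ, EuclideanSpace ℝ (Fin m)) (𝓡 m) (extChartAt (𝓡 m) p).symm
        (range (𝓡 m)) (extChartAt (𝓡 m) p x)).comp
        (mfderiv (𝓡 m) 𝓘(ℝ, EuclideanSpace ℝ (Fin m)) (extChartAt (𝓡 m) p) x)) v = v := by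
      rw [h]; rfl
    exact h2
  have hkey : mvfderiv (𝓡 m) ψ x v = fderiv ℝ Φ (extChartAt (𝓡 m) p x) w := by
    conv_lhs => rw [← hv]
    rw [mvfderiv_apply_mfderivWithin_symm hxc hψd w, hrepr.fderiv_eq]
  rw [hkey]
  calc |fderiv ℝ Φ (extChartAt (𝓡 m) p x) w| ≤ D * ‖A w‖ := hDb w
    _ ≤ D * (C * Real.sqrt (g₀.inner x v v)) := mul_le_mul_of_nonneg_left (hcomp v) hD
    _ = C * D * Real.sqrt ((ofRiemannian g₀).val x v v) := by rw [val_ofRiemannian]; ring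

end Gradient

end Literature.Geometry.Riemannian

end
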